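import Summits.QuantumFields.YangMills.Theorems.BalabanUVNodesN13TStepDensityIsTransportAtRecord13CoPH

/-!
# BalabanUVNodes ∕ N13 — UNDER THE TREE's SELECTOR LAW (ii) AS TYPED («the selector moves only DEAD sequences», the hypothesis `hdead` of K1⁷'s N13 node files; filed in the tree under
# the cite [IV] p.177 (i)–(ii), which in print are the COMPONENT conditions — ref-M READ-9 LOCATED-1) THE 𝐑-STEP OF RECORD
# IS SUB-IDENTITY AT EVERY FIELD: `slot_{k+1}(s′) = slotT_{k+1}(s′)·(x∕x)`, `x = ∫⌈_{Z′(s′)} t_{s′}` — hence `0 ≤ slot_{k+1} ≤ slotT_{k+1}`, `ρ_{k+1} ≤ 𝐓ρ_k = T_k(ρ_k)` POINTWISE and the sharp sup road,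
# for EVERY admissible parameter with law (ii), not only at live selectors (Track A, DAG node N13 = [B16]; cluster K1 — K1⁷ `StabilityBAtRecordR13SepCoPH` = stmt-QuantumFields-20542,
# helper; seat `pub-ymgap-dag-n13-w3` g3, companion of p609235 (𝐑-ratio row by name) and `…N13TStepDensityIsTransportAtRecord13CoPH`; 2026-08-28; count-neutral)

HONEST FRAMING.  Count-neutral kernel BOOKKEEPING; nothing of Bałaban's is asserted.  K1⁷'s N13 node files (p583899 `laws₁₃CoPH_of_selLaws_coPH`, this seat's F3 p604459 ∕ F6 p610463)
carry the tree's selector laws AS TYPED (cited there under [IV] p.177 (i)–(ii); print's (i)–(ii) are the component conditions, ref-M READ-9 LOCATED-1): (i) `hidem` idempotence and (ii) `hdead` «a moved sequence has identically vanishing own fibre mass `∫⌈_{Z′(a)} t_a ≡ 0`»; dag-n11-e's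
`B16RLeafRecord12Live` named this the DEAD-MOVING branch and dag-n13-w1 g0's p583899 proved `ρ_{k+1} =ᵃᵉ 𝐓ρ_k` there; dag-n13-w1 g4's p607786 proved the POINTWISE `0 ≤ slot_{k+1} ≤
slotT_{k+1}`, `ρ_{k+1} ≤ 𝐓ρ_k` at K0a's LIVE selector.  THIS FILE proves the pointwise statements FOR EVERY SELECTOR OBEYING LAW (ii) — the hypothesis the node files actually carry:
(§1, generic over def-T's slot families, law (ii) at level `k+1` only — idempotence is NOT needed) by p609235's by-name 𝐑-factor `slot_{k+1}(s′) = slotT_{k+1}(s′)·Σ_{a ∈ sel⁻¹ s′}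
rratio(a, s′)` and dag-n11-e's `rratio_eq_zero_of_dead`, every MOVED member of the fibre contributes `0`, a moved `s′` is itself dead, so ★ `Σ_{a ∈ sel⁻¹ s′} rratio(a, s′)(V) =
rratio(s′, s′)(V) = x∕x` and `slot_{k+1}(s′)(V) = slotT_{k+1}(s′)(V)·(x∕x)`, `x = ∫⌈_{Z′(s′)} t_{s′}(V)`: THE 𝐑-STEP OF RECORD NEVER MIXES HISTORIES under law (ii) — it only kills, fibrewise,
the terms of zero own fibre mass; (§2, at K1⁷'s record with `Provisos₁₃CoPH`, slots `≥ 0`) ★ `0 ≤ slot_{k+1} ≤ slotT_{k+1}` and ★★ `ρ_{k+1}(V′) ≤ 𝐓ρ_k(V′) = T_k(ρ_k)(V′)` at EVERY field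
(with `…N13TStepDensityIsTransportAtRecord13CoPH` under its measurable-bounded term row), and ★★★ the sharp sup road `ρ_k ≤ e^{−E(P)}·Π_{j<k} D_j` from everywhere marginal-density
bounds — for EVERY parameter with law (ii) at the levels `≤ k`.
LOCATED READING (by name, count-neutral; known on the dead-moving branch since `B16RLeafRecord12Live` ∕ p583899's a.e. face, here pointwise and composed with the transport identity):
under law (ii) as typed the density of record satisfies `ρ_k ≤ T_{k−1}(ρ_{k−1}) ≤ …` — it is dominated by (and, by p583899 + K0c's a.e. faces, a.e. EQUAL to) the ITERATED one-step
transport of `ρ₀`, i.e. a version of the `k`-fold BLOCK-AVERAGED Wilson–Gibbs density; so the (UV₁₃) ∕ Cor-3 rows at such parameters are UV-stability statements about the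
UNRENORMALISED averaged density.  [IV]'s 𝐑 ((0.3) with the NONTRIVIAL `Z′` of the p.177 class decision — «removes the main obstacle to prove the ultraviolet stability of
four-dimensional gauge field theories», [IV] abstract; p.175: without it «the small factor … does not control further steps») mixes LIVE histories and is NOT of this kind; print's
(2.50) is stated for the 𝐑-renormalised densities.  Nothing of Bałaban's asserted or refuted; (U1) NOT proved; Cor. 3 NOT proved; N13 NOT discharged; K0⁷ ∕ K1⁷ NOT closed; counts unmoved
(discharged 5∕27 · Track A 5∕28).  ONE finite four-torus programme at fixed `ε = L^{−K}`; R4 closes the conditional finite-𝕋⁴ rung `BalabanLadder.UV` only — the Yang–Mills mass gap (Clay) is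
NOT proved by any of this; nothing continuum ∕ ℝ⁴ ∕ OS.  No `sorry`, `def`, `instance`, `notation`.

Sources: [Balaban1989LargeFieldI] abstract + p.175, (0.2)–(0.4) p.176, (i)–(ii) p.177; [Balaban1988Convergent] (2.18) p.257, Thm 1 p.262, Cor. 3 (2.50) p.264, (3.1) p.264, (3.25) p.270;
[Balaban1989LargeFieldII] (0.1) pp.355–356.
-/

noncomputable section

open MeasureTheory
open scoped BigOperators

namespace Summit.QuantumFields.YangMills.BalabanUVNodes.N13RStepSubIdentityOfDeadSelAtRecord13CoPH

open Literature.MathematicalPhysics.QuantumFieldTheory.Balaban1983to89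
open T4Continuum Node00 B14.Eq218Concrete
open T4AveragingDisintegration (avgDensity)
open B16RLeafRecord12Live (rratio_eq_zero_of_dead)
open Summit.QuantumFields.YangMills.BalabanUVNodes.N13U1StepRRatioRowAtRecord13CoPH (slotsOfRecord_succ_eq_mul_rratioSum abs_div_self_le_one)
open Summit.QuantumFields.YangMills.BalabanUVNodes.N13UVRowRFreeAtLiveSelectorRecord13 (wOfRecord₉_nonneg)
open Summit.QuantumFields.YangMills.BalabanUVNodes.N13TStepDensityIsTransportAtRecord13CoPH
  (tdensOfRecord₁₃_eq_transport_dens histTerm₁₃_nonneg abs_histTerm₁₃_le_of_dens_le)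
open Summit.QuantumFields.YangMills.BalabanUVNodes.N13U1StepMajorantTowerAtRecord13CoPH (abs_transportOfRecord_le transportOfRecord_const_mul)

/-! ## §0. Instance bookkeeping: the restricted integral does not depend on the `DecidableEq` instance on bonds -/

section InstIrrel

variable {P : Params} {j : ℕ} {G : Type*} [GaugeGroup G] [MeasurableSpace G] [HaarData G]

/-- b01's restricted integral `∫⌈_{Z′} f` is the same for any two `DecidableEq` instances on the bonds (they are equal, `Subsingleton.elim`) — bookkeeping between the node files' `hdead`
(global instance) and def-R's classical-instance `rratio`. [folklore] -/
theorem fibreIntegral_inst_irrel (i₁ i₂ : DecidableEq (PBond P j)) (s : Finset (PBond P j)) (f : Density P j G) (V : GaugeField P j G) :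
    @B15.BasicStep.fibreIntegral P j G _ _ _ i₁ s f V = @B15.BasicStep.fibreIntegral P j G _ _ _ i₂ s f V := by
  cases Subsingleton.elim i₁ i₂
  rfl

end InstIrrel

/-! ## §1. GENERIC: under law (ii) the 𝐑-factor is the diagonal ratio `x ∕ x`; the 𝐑-step never mixes histories -/

section Generic

variable (F : T4Family) (N : ℕ) [NeZero N] (ν : Stage7Numerics) (τ : TowerNumerics)
variable (E : B12.RunParams → ℝ) (w : StepWeightsOfRecord F N ν τ.M) (ppSel : PpSelOfRecord F ν τ.M) (p : B12.RunParams) (g : ℕ → ℝ)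

open Classical in
/-- **★ UNDER LAW (ii) THE (0.3) RATIO SUM IS ITS DIAGONAL TERM**: if every sequence MOVED by the selector at level `k+1` has identically vanishing own fibre mass (`hdead`, the node files'
hypothesis), then `Σ_{a : sel(a) = s′} rratio(a, s′)(V) = rratio(s′, s′)(V)` for every `s′` and `V` — a moved member of the fibre contributes `0 ∕ (…) = 0` (`rratio_eq_zero_of_dead`), and if
`s′` itself is moved it is dead, so both sides vanish.  Idempotence (law (i)) is not used. [cite: Balaban1989LargeFieldI, (0.3) p.176, p.177 (i)–(ii) (bookkeeping on the dead-moving branch)] -/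
theorem sum_fiber_rratio_eq_self_of_deadSel (k : ℕ)
    (hdead : ∀ a : SeqOfRecord F ν τ.M g p.K (k + 1), ppSel p g (k + 1) a ≠ a →
      ∀ V, B15.BasicStep.fibreIntegral (fibOfSeq F ν τ p g (k + 1) a)
        (rterm (sliceOfRecord F N ν τ.M p g (k + 1) (slotsTOfRecord F N ν τ E w ppSel p g (k + 1))) a) V = 0)
    (s' : SeqOfRecord F ν τ.M g p.K (k + 1)) (V : GaugeField (F.P p.K) (k + 1) (SU N)) :
    ∑ a ∈ Finset.univ.filter (fun a => ppSel p g (k + 1) a = s'),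
        @rratio (F.P p.K) (SU N) _ _ _ (k + 1) (fun a b => Classical.propDecidable (a = b))
          (sliceOfRecord F N ν τ.M p g (k + 1) (slotsTOfRecord F N ν τ E w ppSel p g (k + 1))) (fibOfSeq F ν τ p g (k + 1)) a s' V
      = @rratio (F.P p.K) (SU N) _ _ _ (k + 1) (fun a b => Classical.propDecidable (a = b))
          (sliceOfRecord F N ν τ.M p g (k + 1) (slotsTOfRecord F N ν τ E w ppSel p g (k + 1))) (fibOfSeq F ν τ p g (k + 1)) s' s' V := by
  -- the node files' `hdead` at def-R's classical bond instance (`fibreIntegral_inst_irrel`)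
  have hdead' : ∀ a : SeqOfRecord F ν τ.M g p.K (k + 1), ppSel p g (k + 1) a ≠ a →
      ∀ V, @B15.BasicStep.fibreIntegral (F.P p.K) (k + 1) (SU N) _ _ _ (fun a b => Classical.propDecidable (a = b)) (fibOfSeq F ν τ p g (k + 1) a)
        (rterm (sliceOfRecord F N ν τ.M p g (k + 1) (slotsTOfRecord F N ν τ E w ppSel p g (k + 1))) a) V = 0 :=
    fun a ha V => (fibreIntegral_inst_irrel (fun a b => Classical.propDecidable (a = b)) inferInstance (fibOfSeq F ν τ p g (k + 1) a)
      (rterm (sliceOfRecord F N ν τ.M p g (k + 1) (slotsTOfRecord F N ν τ E w ppSel p g (k + 1))) a) V).trans (hdead a ha V)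
  refine Finset.sum_eq_single s' (fun a ha has => ?_) (fun hs' => ?_)
  · -- a moved member of the fibre is dead
    have hsel : ppSel p g (k + 1) a = s' := (Finset.mem_filter.1 ha).2
    have hmoved : ppSel p g (k + 1) a ≠ a := by rw [hsel]; exact fun h => has h.symm
    exact rratio_eq_zero_of_dead (hP := fun a b => Classical.propDecidable (a = b))
      (sliceOfRecord F N ν τ.M p g (k + 1) (slotsTOfRecord F N ν τ E w ppSel p g (k + 1))) (fibOfSeq F ν τ p g (k + 1)) a (hdead' a hmoved) s' V
  · -- `s′` not in its own fibre: `s′` is moved, hence dead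
    have hmoved : ppSel p g (k + 1) s' ≠ s' := fun h => hs' (Finset.mem_filter.2 ⟨Finset.mem_univ _, h⟩)
    exact rratio_eq_zero_of_dead (hP := fun a b => Classical.propDecidable (a = b))
      (sliceOfRecord F N ν τ.M p g (k + 1) (slotsTOfRecord F N ν τ E w ppSel p g (k + 1))) (fibOfSeq F ν τ p g (k + 1)) s' (hdead' s' hmoved) s' V

open Classical in
/-- **★ THE 𝐑-STEP OF RECORD NEVER MIXES HISTORIES UNDER LAW (ii)**: `slot_{k+1}(s′)(V) = slotT_{k+1}(s′)(V) · (x ∕ x)`, `x = ∫⌈_{Z′(s′)} t_{s′}(V)` the history's OWN fibre mass at `V`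
(p609235's `slotsOfRecord_succ_eq_mul_rratioSum` + ★ above; `rratio(s′, s′) = x ∕ x` by `rfl`) — the post-𝐑 slot is the pre-𝐑 slot where the own fibre mass is non-zero and `0` where it
vanishes. [cite: Balaban1989LargeFieldI, (0.3) p.176, p.177 (ii); Balaban1988Convergent, Thm 1 p.262 («has again the form (2.18)»)] -/
theorem slotsOfRecord_succ_eq_mul_div_self_of_deadSel (k : ℕ)
    (hdead : ∀ a : SeqOfRecord F ν τ.M g p.K (k + 1), ppSel p g (k + 1) a ≠ a →
      ∀ V, B15.BasicStep.fibreIntegral (fibOfSeq F ν τ p g (k + 1) a)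
        (rterm (sliceOfRecord F N ν τ.M p g (k + 1) (slotsTOfRecord F N ν τ E w ppSel p g (k + 1))) a) V = 0)
    (s' : SeqOfRecord F ν τ.M g p.K (k + 1)) (V : GaugeField (F.P p.K) (k + 1) (SU N)) :
    slotsOfRecord F N ν τ E w ppSel p g (k + 1) s' V =
      slotsTOfRecord F N ν τ E w ppSel p g (k + 1) s' V *
        (B15.BasicStep.fibreIntegral (fibOfSeq F ν τ p g (k + 1) s')
            (rterm (sliceOfRecord F N ν τ.M p g (k + 1) (slotsTOfRecord F N ν τ E w ppSel p g (k + 1))) s') V /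
          B15.BasicStep.fibreIntegral (fibOfSeq F ν τ p g (k + 1) s')
            (rterm (sliceOfRecord F N ν τ.M p g (k + 1) (slotsTOfRecord F N ν τ E w ppSel p g (k + 1))) s') V) := by
  rw [slotsOfRecord_succ_eq_mul_rratioSum, sum_fiber_rratio_eq_self_of_deadSel F N ν τ E w ppSel p g k hdead s' V]
  have hr : @rratio (F.P p.K) (SU N) _ _ _ (k + 1) (fun a b => Classical.propDecidable (a = b))
        (sliceOfRecord F N ν τ.M p g (k + 1) (slotsTOfRecord F N ν τ E w ppSel p g (k + 1))) (fibOfSeq F ν τ p g (k + 1)) s' s' V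
      = @B15.BasicStep.fibreIntegral (F.P p.K) (k + 1) (SU N) _ _ _ (fun a b => Classical.propDecidable (a = b)) (fibOfSeq F ν τ p g (k + 1) s')
          (rterm (sliceOfRecord F N ν τ.M p g (k + 1) (slotsTOfRecord F N ν τ E w ppSel p g (k + 1))) s') V /
        @B15.BasicStep.fibreIntegral (F.P p.K) (k + 1) (SU N) _ _ _ (fun a b => Classical.propDecidable (a = b)) (fibOfSeq F ν τ p g (k + 1) s')
          (rterm (sliceOfRecord F N ν τ.M p g (k + 1) (slotsTOfRecord F N ν τ E w ppSel p g (k + 1))) s') V := rfl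
  rw [hr, fibreIntegral_inst_irrel (fun a b => Classical.propDecidable (a = b)) inferInstance (fibOfSeq F ν τ p g (k + 1) s')
    (rterm (sliceOfRecord F N ν τ.M p g (k + 1) (slotsTOfRecord F N ν τ E w ppSel p g (k + 1))) s') V]

open Classical in
/-- **`|slot_{k+1}(s′)| ≤ |slotT_{k+1}(s′)|` under law (ii)** (`|x ∕ x| ≤ 1`): the 𝐑-ratio row of p607601's tower holds with `c_R = 1` for EVERY selector obeying law (ii), not only at live selectors.
[cite: Balaban1989LargeFieldI, (0.3) p.176, p.177 (ii) (bookkeeping)] -/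
theorem abs_slotsOfRecord_succ_le_of_deadSel (k : ℕ)
    (hdead : ∀ a : SeqOfRecord F ν τ.M g p.K (k + 1), ppSel p g (k + 1) a ≠ a →
      ∀ V, B15.BasicStep.fibreIntegral (fibOfSeq F ν τ p g (k + 1) a)
        (rterm (sliceOfRecord F N ν τ.M p g (k + 1) (slotsTOfRecord F N ν τ E w ppSel p g (k + 1))) a) V = 0)
    (s' : SeqOfRecord F ν τ.M g p.K (k + 1)) (V : GaugeField (F.P p.K) (k + 1) (SU N)) :
    |slotsOfRecord F N ν τ E w ppSel p g (k + 1) s' V| ≤ |slotsTOfRecord F N ν τ E w ppSel p g (k + 1) s' V| := by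
  rw [slotsOfRecord_succ_eq_mul_div_self_of_deadSel F N ν τ E w ppSel p g k hdead s' V, abs_mul]
  exact (mul_le_mul_of_nonneg_left (abs_div_self_le_one _) (abs_nonneg _)).trans_eq (mul_one _)

end Generic

/-! ## §2. AT K1⁷'s RECORD under law (ii): `0 ≤ slot_{k+1} ≤ slotT_{k+1}`, `ρ_{k+1} ≤ 𝐓ρ_k = T_k(ρ_k)` pointwise, the sharp sup road -/

section AtRecord

variable (F : T4Family) (N : ℕ) [NeZero N]
variable (θ : Stage13HParams F N) (P : B12.RunParams)

open Classical in
/-- **★ `0 ≤ slot_{k+1}(s′)(V) ≤ slotT_{k+1}(s′)(V)` AT THE STAGE-13 RECORD UNDER LAW (ii)** (slots of record are `≥ 0` under the ζ-laws of `Provisos₁₃CoPH`: K0's `slotsOfRecord_nonneg` ∕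
`slotsTOfRecord_nonneg` at `wOfRecord₉ ≥ 0`) — dag-n13-w1 g4's live-selector statement (p607786) for EVERY selector with law (ii). [cite: Balaban1989LargeFieldI, (0.3) p.176, p.177 (ii); Balaban1988Convergent, (3.24)–(3.25) p.270] -/
theorem slotsOfRecord₁₃_succ_le_slotsT_of_deadSel (h : θ.Provisos₁₃CoPH F N) (k : ℕ)
    (hdead : ∀ a : SeqOfRecord F θ.ν θ.τ9.M (gOfRecord₁₃ F N θ.toStage13Params P) P.K (k + 1), θ.ppSel P (gOfRecord₁₃ F N θ.toStage13Params P) (k + 1) a ≠ a →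
      ∀ V, B15.BasicStep.fibreIntegral (fibOfSeq F θ.ν θ.τ9 P (gOfRecord₁₃ F N θ.toStage13Params P) (k + 1) a)
        (rterm (sliceOfRecord F N θ.ν θ.τ9.M P (gOfRecord₁₃ F N θ.toStage13Params P) (k + 1)
          (slotsTOfRecord F N θ.ν θ.τ9 (EOfRecord₁₃ F N θ.toStage13Params) (wOfRecord₉ F N θ.toStage9Params) θ.ppSel P (gOfRecord₁₃ F N θ.toStage13Params P) (k + 1))) a) V = 0)
    (s' : SeqOfRecord F θ.ν θ.τ9.M (gOfRecord₁₃ F N θ.toStage13Params P) P.K (k + 1)) (V : GaugeField (F.P P.K) (k + 1) (SU N)) :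
    0 ≤ slotsOfRecord F N θ.ν θ.τ9 (EOfRecord₁₃ F N θ.toStage13Params) (wOfRecord₉ F N θ.toStage9Params) θ.ppSel P (gOfRecord₁₃ F N θ.toStage13Params P) (k + 1) s' V ∧
    slotsOfRecord F N θ.ν θ.τ9 (EOfRecord₁₃ F N θ.toStage13Params) (wOfRecord₉ F N θ.toStage9Params) θ.ppSel P (gOfRecord₁₃ F N θ.toStage13Params P) (k + 1) s' V ≤
      slotsTOfRecord F N θ.ν θ.τ9 (EOfRecord₁₃ F N θ.toStage13Params) (wOfRecord₉ F N θ.toStage9Params) θ.ppSel P (gOfRecord₁₃ F N θ.toStage13Params P) (k + 1) s' V := by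
  have hw0 := wOfRecord₉_nonneg θ.toStage13Params h.zetaUnity h.zetaAbs
  have h0 := slotsOfRecord_nonneg F N θ.ν θ.τ9 (EOfRecord₁₃ F N θ.toStage13Params) hw0 θ.ppSel P (gOfRecord₁₃ F N θ.toStage13Params P) (k + 1) s' V
  have h0T := slotsTOfRecord_nonneg F N θ.ν θ.τ9 (EOfRecord₁₃ F N θ.toStage13Params) hw0 θ.ppSel P (gOfRecord₁₃ F N θ.toStage13Params P) (k + 1) s' V
  have hle := abs_slotsOfRecord_succ_le_of_deadSel F N θ.ν θ.τ9 (EOfRecord₁₃ F N θ.toStage13Params) (wOfRecord₉ F N θ.toStage9Params) θ.ppSel P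
    (gOfRecord₁₃ F N θ.toStage13Params P) k hdead s' V
  rw [abs_of_nonneg h0, abs_of_nonneg h0T] at hle
  exact ⟨h0, hle⟩

open Classical in
/-- **★★ `ρ_{k+1}(V′) ≤ 𝐓ρ_k(V′)` AT EVERY FIELD UNDER LAW (ii)** (termwise ★ above with `χ_{k+1} ≥ 0`; p583899's `… =ᵃᵉ …` is the known a.e. face, p607786's the live-selector case).
[cite: Balaban1989LargeFieldI, (0.2)–(0.4) p.176, p.177 (ii); Balaban1988Convergent, (2.18) p.257, (3.25) p.270] -/
theorem densOfRecord₁₃_succ_le_tdens_of_deadSel (h : θ.Provisos₁₃CoPH F N) (k : ℕ)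
    (hdead : ∀ a : SeqOfRecord F θ.ν θ.τ9.M (gOfRecord₁₃ F N θ.toStage13Params P) P.K (k + 1), θ.ppSel P (gOfRecord₁₃ F N θ.toStage13Params P) (k + 1) a ≠ a →
      ∀ V, B15.BasicStep.fibreIntegral (fibOfSeq F θ.ν θ.τ9 P (gOfRecord₁₃ F N θ.toStage13Params P) (k + 1) a)
        (rterm (sliceOfRecord F N θ.ν θ.τ9.M P (gOfRecord₁₃ F N θ.toStage13Params P) (k + 1)
          (slotsTOfRecord F N θ.ν θ.τ9 (EOfRecord₁₃ F N θ.toStage13Params) (wOfRecord₉ F N θ.toStage9Params) θ.ppSel P (gOfRecord₁₃ F N θ.toStage13Params P) (k + 1))) a) V = 0) :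
    ∀ V' : GaugeField (F.P P.K) (k + 1) (SU N), densOfRecord₁₃ F N θ.toStage13Params P (k + 1) V' ≤ tdensOfRecord₁₃ F N θ.toStage13Params P k V' := by
  intro V'
  show ∑ s', _ ≤ ∑ s', _
  exact Finset.sum_le_sum fun s' _ =>
    mul_le_mul_of_nonneg_left (slotsOfRecord₁₃_succ_le_slotsT_of_deadSel F N θ P h k hdead s' V').2
      (chiSeqOfRecord_nonneg F N θ.ν θ.τ9.M _ P.K (k + 1) s' V')

open Classical in
/-- **★★ `ρ_{k+1}(V′) ≤ T_k(ρ_k)(V′)` AT EVERY FIELD UNDER LAW (ii)** (★★ above ∘ `tdensOfRecord₁₃_eq_transport_dens` under its measurable-bounded term row, `k < K`): the 𝐑-step and the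
whole (2.18) index are gone — under law (ii) the density of record is dominated step by step by the ITERATED TRANSPORT of `ρ₀`, the unrenormalised block-averaged Gibbs density.
[cite: Balaban1989LargeFieldI, (0.3) p.176, p.177 (ii), p.175; Balaban1988Convergent, (3.1) p.264] -/
theorem densOfRecord₁₃_succ_le_transport_dens_of_deadSel (h : θ.Provisos₁₃CoPH F N) (k : ℕ) (hk : k < P.K)
    (hdead : ∀ a : SeqOfRecord F θ.ν θ.τ9.M (gOfRecord₁₃ F N θ.toStage13Params P) P.K (k + 1), θ.ppSel P (gOfRecord₁₃ F N θ.toStage13Params P) (k + 1) a ≠ a →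
      ∀ V, B15.BasicStep.fibreIntegral (fibOfSeq F θ.ν θ.τ9 P (gOfRecord₁₃ F N θ.toStage13Params P) (k + 1) a)
        (rterm (sliceOfRecord F N θ.ν θ.τ9.M P (gOfRecord₁₃ F N θ.toStage13Params P) (k + 1)
          (slotsTOfRecord F N θ.ν θ.τ9 (EOfRecord₁₃ F N θ.toStage13Params) (wOfRecord₉ F N θ.toStage9Params) θ.ppSel P (gOfRecord₁₃ F N θ.toStage13Params P) (k + 1))) a) V = 0)
    {B : ℝ}
    (hmeas : ∀ s : SeqOfRecord F θ.ν θ.τ9.M (gOfRecord₁₃ F N θ.toStage13Params P) P.K k,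
      Measurable (fun U => chiSeqOfRecord F N θ.ν θ.τ9.M (gOfRecord₁₃ F N θ.toStage13Params P) P.K k s U *
        slotsOfRecord F N θ.ν θ.τ9 (EOfRecord₁₃ F N θ.toStage13Params) (wOfRecord₉ F N θ.toStage9Params) θ.ppSel P (gOfRecord₁₃ F N θ.toStage13Params P) k s U))
    (hB : ∀ (s : SeqOfRecord F θ.ν θ.τ9.M (gOfRecord₁₃ F N θ.toStage13Params P) P.K k) U,
      |chiSeqOfRecord F N θ.ν θ.τ9.M (gOfRecord₁₃ F N θ.toStage13Params P) P.K k s U *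
        slotsOfRecord F N θ.ν θ.τ9 (EOfRecord₁₃ F N θ.toStage13Params) (wOfRecord₉ F N θ.toStage9Params) θ.ppSel P (gOfRecord₁₃ F N θ.toStage13Params P) k s U| ≤ B) :
    ∀ V' : GaugeField (F.P P.K) (k + 1) (SU N),
      densOfRecord₁₃ F N θ.toStage13Params P (k + 1) V' ≤ transportOfRecord F N P.K k (densOfRecord₁₃ F N θ.toStage13Params P k) V' := fun V' =>
  (densOfRecord₁₃_succ_le_tdens_of_deadSel F N θ P h k hdead V').trans (tdensOfRecord₁₃_eq_transport_dens F N θ P h k hk hmeas hB V').le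

open Classical in
/-- **★★★ THE SHARP SUP ROAD UNDER LAW (ii) AT EVERY LEVEL** (the node files' hypothesis, EVERY selector obeying it): from everywhere marginal-density VERSION bounds `avgDensity_j(V′) ≤ D_j`
(`j < k`) and the measurability row on the history terms, `ρ_k(V) ≤ e^{−E(P)}·Π_{j<k} D_j` at EVERY field — no history count, no small factor, and, per the LOCATED reading in the header,
NO VALUE for (2.50) (`E(P)` extensive at every scale).  Nothing of Bałaban's asserted. [cite: Balaban1989LargeFieldI, (0.3) p.176, p.177 (ii), p.175; Balaban1988Convergent, Thm 1 p.262, Cor. 3 (2.50) p.264] -/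
theorem densOfRecord₁₃_le_exp_mul_prod_of_avgDensity_le_of_deadSel (h : θ.Provisos₁₃CoPH F N) (k : ℕ) (hk : k ≤ P.K) (D : ℕ → ℝ)
    (hdead : ∀ j, j < k → ∀ a : SeqOfRecord F θ.ν θ.τ9.M (gOfRecord₁₃ F N θ.toStage13Params P) P.K (j + 1), θ.ppSel P (gOfRecord₁₃ F N θ.toStage13Params P) (j + 1) a ≠ a →
      ∀ V, B15.BasicStep.fibreIntegral (fibOfSeq F θ.ν θ.τ9 P (gOfRecord₁₃ F N θ.toStage13Params P) (j + 1) a)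
        (rterm (sliceOfRecord F N θ.ν θ.τ9.M P (gOfRecord₁₃ F N θ.toStage13Params P) (j + 1)
          (slotsTOfRecord F N θ.ν θ.τ9 (EOfRecord₁₃ F N θ.toStage13Params) (wOfRecord₉ F N θ.toStage9Params) θ.ppSel P (gOfRecord₁₃ F N θ.toStage13Params P) (j + 1))) a) V = 0)
    (hD : ∀ j, j < k → ∀ V' : GaugeField (F.P P.K) (j + 1) (SU N), (avgDensity (avOfRecord F N P.K j).avg V' : ℝ) ≤ D j)
    (hmeas : ∀ j, j < k → ∀ s : SeqOfRecord F θ.ν θ.τ9.M (gOfRecord₁₃ F N θ.toStage13Params P) P.K j,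
      Measurable (fun U => chiSeqOfRecord F N θ.ν θ.τ9.M (gOfRecord₁₃ F N θ.toStage13Params P) P.K j s U *
        slotsOfRecord F N θ.ν θ.τ9 (EOfRecord₁₃ F N θ.toStage13Params) (wOfRecord₉ F N θ.toStage9Params) θ.ppSel P (gOfRecord₁₃ F N θ.toStage13Params P) j s U)) :
    ∀ V : GaugeField (F.P P.K) k (SU N),
      densOfRecord₁₃ F N θ.toStage13Params P k V ≤ Real.exp (-EOfRecord₁₃ F N θ.toStage13Params P) * ∏ j ∈ Finset.range k, D j := by
  induction k with
  | zero =>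
    intro V
    rw [densOfRecord₁₃_zero, Finset.range_zero, Finset.prod_empty, mul_one]
    exact rhoZeroOfRecord_le F N P.K _ _ V
  | succ k ih =>
    intro V'
    have hkK : k < P.K := Nat.lt_of_succ_le hk
    have ih' := ih hkK.le (fun j hj => hdead j (Nat.lt_succ_of_lt hj)) (fun j hj => hD j (Nat.lt_succ_of_lt hj)) (fun j hj => hmeas j (Nat.lt_succ_of_lt hj))
    have hB0 : 0 ≤ Real.exp (-EOfRecord₁₃ F N θ.toStage13Params P) * ∏ j ∈ Finset.range k, D j := by
      refine mul_nonneg (Real.exp_pos _).le (Finset.prod_nonneg fun j hj => ?_)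
      have W : GaugeField (F.P P.K) (j + 1) (SU N) := fun _ => 1
      exact (NNReal.coe_nonneg _).trans (hD j (Nat.lt_succ_of_lt (Finset.mem_range.1 hj)) W)
    -- `ρ_{k+1} ≤ T_k(ρ_k) ≤ (sup ρ_k)·avgDensity_k ≤ (sup ρ_k)·D_k`
    have hterm := abs_histTerm₁₃_le_of_dens_le F N θ P h k ih'
    have h1 := densOfRecord₁₃_succ_le_transport_dens_of_deadSel F N θ P h k hkK (hdead k (Nat.lt_succ_self k)) (hmeas k (Nat.lt_succ_self k)) hterm V'
    have hρ0 : ∀ U, 0 ≤ densOfRecord₁₃ F N θ.toStage13Params P k U := fun U =>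
      Finset.sum_nonneg fun s _ => histTerm₁₃_nonneg F N θ P h k s U
    have hdom := abs_transportOfRecord_le F N P.K k (h := densOfRecord₁₃ F N θ.toStage13Params P k)
      (H := fun _ => Real.exp (-EOfRecord₁₃ F N θ.toStage13Params P) * ∏ j ∈ Finset.range k, D j)
      (fun U => by rw [abs_of_nonneg (hρ0 U)]; exact ih' U) measurable_const (C := _) (fun _ => le_rfl) V'
    have hconst : transportOfRecord F N P.K k (fun _ => Real.exp (-EOfRecord₁₃ F N θ.toStage13Params P) * ∏ j ∈ Finset.range k, D j) V'
        = (Real.exp (-EOfRecord₁₃ F N θ.toStage13Params P) * ∏ j ∈ Finset.range k, D j) * (avgDensity (avOfRecord F N P.K k).avg V' : ℝ) := by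
      have hc := transportOfRecord_const_mul F N P.K k (Real.exp (-EOfRecord₁₃ F N θ.toStage13Params P) * ∏ j ∈ Finset.range k, D j) (fun _ => (1 : ℝ)) V'
      simp only [mul_one] at hc
      rw [hc]
      simp only [transportOfRecord, T4AveragingDisintegration.transportK, T4AveragingDisintegration.kernelTransport, integral_const, smul_eq_mul,
        probReal_univ, one_mul]
      ring
    calc densOfRecord₁₃ F N θ.toStage13Params P (k + 1) V'
        ≤ transportOfRecord F N P.K k (densOfRecord₁₃ F N θ.toStage13Params P k) V' := h1
      _ ≤ (Real.exp (-EOfRecord₁₃ F N θ.toStage13Params P) * ∏ j ∈ Finset.range k, D j) * (avgDensity (avOfRecord F N P.K k).avg V' : ℝ) :=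
          (le_abs_self _).trans (hdom.trans_eq hconst)
      _ ≤ (Real.exp (-EOfRecord₁₃ F N θ.toStage13Params P) * ∏ j ∈ Finset.range k, D j) * D k :=
          mul_le_mul_of_nonneg_left (hD k (Nat.lt_succ_self k) V') hB0
      _ = Real.exp (-EOfRecord₁₃ F N θ.toStage13Params P) * ∏ j ∈ Finset.range (k + 1), D j := by
          rw [Finset.prod_range_succ]; ring

end AtRecord

end Summit.QuantumFields.YangMills.BalabanUVNodes.N13RStepSubIdentityOfDeadSelAtRecord13CoPH

end
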